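import Literature.NumberTheory.Automorphic.AshSmithTheoryHeckeDoubleCosetProofs
import HarnessLib

/-!
# Ash (2003), *Smith theory and Hecke operators* — proofs towards the named fact
# `Ash2003_inducedRayClassCharacter_attached`: the Hecke operators `T_{l,k}` commute

Topic `NumberTheory/Automorphic`; companion of `Literature.NumberTheory.Automorphic.AshSmithTheoryHecke`
(the named fact `Ash2003_inducedRayClassCharacter_attached` = A. Ash, *Smith theory and Hecke
operators*, J. Algebra **259** (2003) 43–58 [Ash2003], Thm. 1.1 / Cor. 4.4).  The fact asks for
simultaneous eigenclasses of the operators `T_{l,k} = [K_f(M) s_{l,k} K_f(M)]` (`Ash2003.heckeT`) on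
`H^i(X(M), F)` for `l ∤ M`; [Ash2003] works throughout with "the Hecke algebra `ℋ`" generated by
them, which is commutative.  This file proves that commutativity in the tree's typing:

* `Ash2003.heckeT_comm`: for `M ≠ 0`, places `v, w ∤ M` and all `k, j`,
  `T_{v,k} T_{w,j} = T_{w,j} T_{v,k}` on `H^i(X(M), F)` (any field `F`, any degree `i`).

Proof: the level `K_f(M)` is unramified at `v ∤ M` (`Ash2003.isUnramifiedLevel_finiteLevel`) and
`s_{l,k}` is the local element `ιᵥ(diag(l,…,l,1,…,1))` (`Ash2003.heckeElement_eq_ofLocal_heckeDiag`,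
both in `AshSmithTheoryHeckeDoubleCosetProofs`), so the tree's local–global commutativity theorems
apply (`ArithmeticQuotientHeckeLocal`): different places commute because `ιᵥ(GL_n(ℚ_v))` and
`ι_w(GL_n(ℚ_w))` do (`heckeOperator_comm_of_orthogonal`), one place by Gelfand's trick with the
transpose and the Cartan decomposition (`heckeOperator_comm_of_antiInvolution`,
`exists_glTranspose_eq_mul_mul_adicCompletion`; [Bump1997, Thm. 4.6.1]) — exactly as for the big
Hecke algebra of `GL_n` (`BigHeckeGLn.TameLevel.heckeGenerators_commute_holds`).  Together with the
lifting lemma `Literature.LinearAlgebra.exists_forall_apply_eq_smul_of_forall_sub_smul_mem`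
(commuting operators: eigenvalue systems in stable subquotients occur in the module) this is the
algebra behind [Ash2003, §3].

## References

* A. Ash, *Smith theory and Hecke operators*, J. Algebra 259 (2003) 43–58, §§2–3 [Ash2003].
* D. Bump, *Automorphic forms and representations* (1997), Thm. 4.6.1 [Bump1997].
-/

noncomputable section

open scoped NumberField
open IsDedekindDomain CategoryTheory

namespace Literature.NumberTheory.Automorphic

namespace Ash2003

/-- **The Hecke operators of the fact commute**: for `M ≠ 0`, finite places `v, w` of `ℚ` not
dividing `M` and all `k, j`, `T_{v,k} ∘ T_{w,j} = T_{w,j} ∘ T_{v,k}` on `H^i(X(M), F)`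
(`Ash2003.heckeT`; any field `F`, any `i`).  Different places: the local embeddings commute;
the same place: Gelfand's trick (transpose + Cartan decomposition, [Bump1997, Thm. 4.6.1]).
[cite: Ash2003, §2] -/
theorem heckeT_comm (n : ℕ) {M : ℕ} (hM : M ≠ 0) (F : Type) [Field F] (i : ℕ)
    {v w : HeightOneSpectrum (𝓞 ℚ)} (hv : ¬ v.residueCard ∣ M) (hw : ¬ w.residueCard ∣ M)
    (k j : ℕ) :
    heckeT n M F i v k * heckeT n M F i w j = heckeT n M F i w j * heckeT n M F i v k := by
  have hcomp :
      ArithmeticQuotient.heckeOperator F (finiteLevel n M) (heckeElement n w j) F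
          (posDetToFiniteAdelic n) i ≫
        ArithmeticQuotient.heckeOperator F (finiteLevel n M) (heckeElement n v k) F
          (posDetToFiniteAdelic n) i =
      ArithmeticQuotient.heckeOperator F (finiteLevel n M) (heckeElement n v k) F
          (posDetToFiniteAdelic n) i ≫
        ArithmeticQuotient.heckeOperator F (finiteLevel n M) (heckeElement n w j) F
          (posDetToFiniteAdelic n) i := by
    rw [heckeElement_eq_ofLocal_heckeDiag n v k, heckeElement_eq_ofLocal_heckeDiag n w j]
    by_cases hvw : v = w
    · subst hvw
      exact ArithmeticQuotient.heckeOperator_comm_of_antiInvolution F F (posDetToFiniteAdelic n)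
        (isUnramifiedLevel_finiteLevel n hM hv) (glTranspose (Fin n))
        (fun κ hκ => glTranspose_mem_valuedCongruenceSubgroup hκ) glTranspose_glTranspose
        (exists_glTranspose_eq_mul_mul_adicCompletion v (Fin n)) _ _ i
    · exact ArithmeticQuotient.heckeOperator_comm_of_orthogonal F F (posDetToFiniteAdelic n)
        (isUnramifiedLevel_finiteLevel n hM hv) (isUnramifiedLevel_finiteLevel n hM hw)
        (fun g => BigHeckeGLn.localComponent_ofLocal_of_ne (Ne.symm hvw) g) _ _ i
  rw [Module.End.mul_eq_comp, Module.End.mul_eq_comp]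
  change ((ArithmeticQuotient.heckeOperator F (finiteLevel n M) (heckeElement n v k) F
      (posDetToFiniteAdelic n) i).hom ∘ₗ
      (ArithmeticQuotient.heckeOperator F (finiteLevel n M) (heckeElement n w j) F
        (posDetToFiniteAdelic n) i).hom) =
    (ArithmeticQuotient.heckeOperator F (finiteLevel n M) (heckeElement n w j) F
      (posDetToFiniteAdelic n) i).hom ∘ₗ
      (ArithmeticQuotient.heckeOperator F (finiteLevel n M) (heckeElement n v k) F
        (posDetToFiniteAdelic n) i).hom
  rw [← ModuleCat.hom_comp, ← ModuleCat.hom_comp, hcomp]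

/-- The operators `T_{v,k}`, `v ∤ M`, form a pairwise commuting family indexed by the good places and
all `k` (the form consumed by the lifting lemma
`Literature.LinearAlgebra.exists_forall_apply_eq_smul_of_forall_sub_smul_mem`). [folklore] -/
theorem commute_heckeT (n : ℕ) {M : ℕ} (hM : M ≠ 0) (F : Type) [Field F] (i : ℕ)
    (x y : {vk : HeightOneSpectrum (𝓞 ℚ) × ℕ // ¬ vk.1.residueCard ∣ M}) :
    Commute (heckeT n M F i x.1.1 x.1.2) (heckeT n M F i y.1.1 y.1.2) :=
  heckeT_comm n hM F i x.2 y.2 x.1.2 y.1.2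

end Ash2003

end Literature.NumberTheory.Automorphic
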